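import Summits.CriticalPhenomena.PercolationContinuityZ3.Theorems.FK.EnergyLargeDeviations
import Summits.CriticalPhenomena.PercolationContinuityZ3.Theorems.FK.PressureZeroTemperature
import HarnessLib

/-!
# LARGE DEVIATIONS OF THE ENERGY ON `ℤ^d`, II: THE `β`-TILTING LOWER BOUND, THE LEGENDRE RATE AT EXPOSED POINTS,
# AND THE LATENT-HEAT PLATEAU `[Σᵢ⟨σ_0σ_{eᵢ}⟩^∅_β, Σᵢ⟨σ_0σ_{eᵢ}⟩⁺_β]`
# (Ellis 2006, Thm. II.6.1 (b)–(c), §IV.7; Lanford 1973; Lebowitz 1977)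

Claimed R42 (8)(c) in the cell INBOX at 2026-08-29T10:53:14Z by fkp-10a gen 359 (NEW CLAIM #10 of the gen), addressed to coordinator fk-4 gen 295 (planner-prim-bschramm-fk-4-g295-0, SEATED l.8862; ruling R181 requested); lineage row FO-10a-g359j (self-suggested), package g359-energylower, label LD-J.
Companion of `EnergyLargeDeviations` (Chernoff UPPER bounds for the energy density `−H_N/|Λ_N|` under the finite-volume
Gibbs states `μ^{bc}_{Λ_N;β,h}`, ARBITRARY boundary condition). LOWER bound: `μ_β` is `μ_{β+s}` tilted by `e^{sH_Λ}`, so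
`e^{−sa − |s|δ} (Z_{β+s}/Z_β) μ_{β+s}{|−H_Λ − a| < δ} ≤ μ_β{|−H_Λ − a| < δ}` (`exp_mul_measureReal_energyWindow_le`, every graph /
volume / b.c.); on `ℤ^d`, at an EXPOSED point `D = ∂ψ/∂β(β+s,h)` the tilted window has mass `→ 1`, whence for every
`δ, ε > 0` and EVERY b.c. eventually `exp(−|Λ_N| (sD − (ψ(β+s,h) − ψ(β,h)) + |s|δ + ε)) ≤ μ^{bc}_{Λ_N;β,h}{|−H_N/|Λ_N| − D| < δ}`
(`energy_ld_lower_bound_of_hasDerivAt`); the exponent is the Legendre transform of `s ↦ ψ(β+s,h) − ψ(β,h)` at `D`, ATTAINED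
at `s` (`energy_rate_le_rate_of_hasDerivAt`), matching the upper bound. Between the one-sided `β`-derivatives the rate
VANISHES (`energy_rate_nonpos_of_mem_Icc`): at `h = 0` it is ZERO on Lebowitz's whole
LATENT-HEAT INTERVAL `[Σᵢ⟨σ_0σ_{eᵢ}⟩^∅_β, Σᵢ⟨σ_0σ_{eᵢ}⟩⁺_β]` (`energy_rate_nonpos_zero_field_of_mem_Icc`) and positive
off it (`energy_rate_pos_zero_field_of_lt/gt`); and BOTH ENDPOINTS ARE REACHED AT SUB-VOLUME-ORDER COST UNDER EVERY b.c.: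
for every `δ, ε > 0`, eventually `e^{−ε|Λ_N|} ≤ μ^{bc}_{Λ_N;β,0}{|−H_N/|Λ_N| − Σᵢ⟨σ_0σ_{eᵢ}⟩⁺_β| < δ}` (`energy_ld_lower_plus_nn`,
`β ≥ 0`) and likewise at `Σᵢ⟨σ_0σ_{eᵢ}⟩^∅_β` (`energy_ld_lower_free_nn`, `β > 0`) — exposed inverse temperatures are dense
(`countable_not_differentiableAt_pressure_beta`) and the plus / free energies are right / left continuous in `β`.

Helper file of the `fk-continuity` build cell (bschramm lane; `--supports stmt-CriticalPhenomena-4575`; fkp-10a gen 359,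
package g359-energylower, label LD-J); builds on p205010 (kernel theorem, internal audit signed; external expert review
pending). No definitions, no named facts, no sorries; standard axioms. UNCONDITIONAL (nearest-neighbour Ising model; the
tilting inequality on ANY finite volume of a locally finite graph with ANY boundary condition and all real `β, s, h, a, δ`;
`ℤ^d` boxes `Λ_N = {−N,…,N}^d`, `d ≥ 1`, EVERY boundary condition for the asymptotic lower bounds; `β, h` as each theorem
states). LOWER bounds and rate identification only: no rate-function object / full LDP, no level-2/3, no uniformity in
the boundary condition, no magnetisation statement; nothing percolation-bearing.
* O. E. Lanford, *Entropy and equilibrium states in classical statistical mechanics*, LNP 20 (1973). [Lanford1973]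
* R. S. Ellis, *Entropy, Large Deviations, and Statistical Mechanics*, Springer (2006), Thm. II.6.1, §IV.7. [Ellis2006]
* J. L. Lebowitz, *Coexistence of phases in Ising ferromagnets*, J. Stat. Phys. 16 (1977) 463–476, Thm. 2. [Lebowitz1977]
* S. Friedli, Y. Velenik, *Statistical Mechanics of Lattice Systems*, CUP (2017), Thm. 3.6. [FriedliVelenik2017]
-/

noncomputable section

namespace Summit.CriticalPhenomena.PercolationContinuityZ3.Theorems.FK

namespace IsingLargeDeviations

open MeasureTheory ProbabilityTheory Filter Topology Finset Set
open Literature.Probability.LatticeModels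

section FiniteVolume

variable {V : Type*} (G : SimpleGraph V) [DecidableEq V] [G.LocallyFinite]

/-- The energy window `{σ | |−H_Λ(σ) − a| < δ}` is measurable. [folklore] -/
theorem measurableSet_energyWindow (Λ : Finset V) (h : ℝ) (bc : BoundaryCondition V) (a δ : ℝ) :
    MeasurableSet {σ : SpinConfig V | |(-isingHamiltonian G Λ h bc σ) - a| < δ} :=
  measurableSet_lt ((measurable_isingHamiltonian G Λ h bc).neg.sub_const a).abs measurable_const

/-- **THE `β`-TILTING INEQUALITY: `e^{−sa − |s|δ} · (Z_{β+s}/Z_β) · μ^{bc}_{Λ;β+s,h}{|−H_Λ − a| < δ} ≤ μ^{bc}_{Λ;β,h}{|−H_Λ − a| < δ}`**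
(any locally finite graph, any volume and boundary condition, all real `β, s, h, a, δ`): `μ_β` is `μ_{β+s}` tilted by
`e^{sH_Λ}` with normalisation `Z_β/Z_{β+s}`, and `e^{sH_Λ} ≥ e^{−sa − |s|δ}` on the window.
[cite: Ellis2006, Thm. II.6.1 (c) (proof, §VII.4) with §IV.7] -/
theorem exp_mul_measureReal_energyWindow_le (Λ : Finset V) (β s h : ℝ) (bc : BoundaryCondition V) (a δ : ℝ) :
    Real.exp (-(s * a) - |s| * δ) *
        (isingPartitionFunction G Λ (β + s) h bc / isingPartitionFunction G Λ β h bc) *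
        (isingMeasure G Λ (β + s) h bc).real {σ | |(-isingHamiltonian G Λ h bc σ) - a| < δ} ≤
      (isingMeasure G Λ β h bc).real {σ | |(-isingHamiltonian G Λ h bc σ) - a| < δ} := by
  set ν := isingMeasure G Λ (β + s) h bc with hν
  set W : Set (SpinConfig V) := {σ | |(-isingHamiltonian G Λ h bc σ) - a| < δ} with hW
  have hWm : MeasurableSet W := measurableSet_energyWindow G Λ h bc a δ
  set f : SpinConfig V → ℝ := fun σ => -s * -isingHamiltonian G Λ h bc σ with hf
  have hμ : isingMeasure G Λ β h bc = ν.tilted f := by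
    have := isingMeasure_add_beta_eq_tilted G Λ (β + s) (-s) h bc
    rwa [add_neg_cancel_right] at this
  have hnorm : ∫ σ, Real.exp (f σ) ∂ν = isingPartitionFunction G Λ β h bc / isingPartitionFunction G Λ (β + s) h bc := by
    have := integral_exp_neg_mul_isingHamiltonian G Λ (β + s) (-s) h bc
    rwa [add_neg_cancel_right] at this
  have hZ : 0 < isingPartitionFunction G Λ β h bc := isingPartitionFunction_pos G Λ β h bc
  have hZ' : 0 < isingPartitionFunction G Λ (β + s) h bc := isingPartitionFunction_pos G Λ _ h bc
  have hreal : (isingMeasure G Λ β h bc).real W = ∫ σ in W, Real.exp (f σ) / ∫ σ', Real.exp (f σ') ∂ν ∂ν := by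
    rw [measureReal_def, hμ, tilted_apply_eq_ofReal_integral' f hWm, ENNReal.toReal_ofReal]
    exact setIntegral_nonneg hWm fun σ _ => by positivity
  set c : ℝ := Real.exp (-(s * a) - |s| * δ) *
    (isingPartitionFunction G Λ (β + s) h bc / isingPartitionFunction G Λ β h bc) with hc
  have hbound : ∀ σ ∈ W, c ≤ Real.exp (f σ) / ∫ σ', Real.exp (f σ') ∂ν := by
    intro σ hσ
    have hσ' : |(-isingHamiltonian G Λ h bc σ) - a| < δ := hσ
    have h1 : s * ((-isingHamiltonian G Λ h bc σ) - a) ≤ |s| * δ :=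
      (le_abs_self _).trans (by rw [abs_mul]; exact mul_le_mul_of_nonneg_left hσ'.le (abs_nonneg _))
    have hexp : Real.exp (-(s * a) - |s| * δ) ≤ Real.exp (f σ) := by
      simp only [hf, Real.exp_le_exp]
      linarith
    rw [hnorm, div_eq_mul_inv, inv_div, hc]
    exact mul_le_mul_of_nonneg_right hexp (div_pos hZ' hZ).le
  have hint : IntegrableOn (fun σ => Real.exp (f σ) / ∫ σ', Real.exp (f σ') ∂ν) W ν :=
    ((integrable_exp_mul_neg_isingHamiltonian G Λ h bc ν (-s)).div_const _).integrableOn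
  have := setIntegral_ge_of_const_le_real hWm (measure_ne_top ν W) hbound hint
  rw [← hreal] at this
  simpa only [hc, mul_assoc] using this

end FiniteVolume

variable {d : ℕ}

/-- The energy-density window equals the energy window: `{|−H/|Λ| − a| < δ} = {|−H − a|Λ|| < δ|Λ|}` (nonempty `Λ`). [folklore] -/
theorem setOf_abs_energy_div_sub_lt_eq {Λ : Finset (Site d)} (hΛ : Λ.Nonempty) (h : ℝ)
    (bc : BoundaryCondition (Site d)) (a δ : ℝ) :
    {σ : SpinConfig (Site d) | |(-isingHamiltonian (zdGraph d) Λ h bc σ) / #Λ - a| < δ} =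
      {σ | |(-isingHamiltonian (zdGraph d) Λ h bc σ) - a * #Λ| < δ * #Λ} := by
  have hV : (0 : ℝ) < #Λ := by exact_mod_cast hΛ.card_pos
  ext σ
  simp only [mem_setOf_eq]
  rw [show (-isingHamiltonian (zdGraph d) Λ h bc σ) / #Λ - a = ((-isingHamiltonian (zdGraph d) Λ h bc σ) - a * #Λ) / #Λ by
    field_simp, abs_div, abs_of_pos hV, div_lt_iff₀ hV]

/-- `|Λ_N|⁻¹ (log Z_{β+s} − log Z_β) → ψ(β+s,h) − ψ(β,h)` along the boxes, every b.c. [cite: Ellis2006, §IV.7; FriedliVelenik2017, Thm. 3.6] -/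
theorem tendsto_pressureIn_beta_sub (β s h : ℝ) (bc : BoundaryCondition (Site d)) :
    Tendsto (fun N : ℕ => pressureIn (zdGraph d) (box d N) (β + s) h bc - pressureIn (zdGraph d) (box d N) β h bc)
      atTop (𝓝 (pressure d (β + s) h - pressure d β h)) :=
  (hasBoxLimit_pressureIn_holds (d := d) (β + s) h bc).sub (hasBoxLimit_pressureIn_holds (d := d) β h bc)

/-- **LOWER BOUND FROM A MASSIVE WINDOW AT THE TILTED INVERSE TEMPERATURE** (`d ≥ 1`): if eventually
`μ^{bc}_{Λ_N;β+s,h}{|−H_N/|Λ_N| − a| < δ} ≥ 1/2`, then for every `ε > 0`, eventually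
`exp(−|Λ_N| (sa − (ψ(β+s,h) − ψ(β,h)) + |s|δ + ε)) ≤ μ^{bc}_{Λ_N;β,h}{|−H_N/|Λ_N| − a| < δ}`.
[cite: Ellis2006, Thm. II.6.1 (c) (proof, §VII.4) with §IV.7] -/
theorem eventually_exp_le_measureReal_energyWindow (hd : 1 ≤ d) (β s h : ℝ) (bc : BoundaryCondition (Site d)) (a δ : ℝ)
    (hW : ∀ᶠ N : ℕ in atTop, (1 / 2 : ℝ) ≤
      (isingMeasure (zdGraph d) (box d N) (β + s) h bc).real
        {σ | |(-isingHamiltonian (zdGraph d) (box d N) h bc σ) / #(box d N) - a| < δ})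
    {ε : ℝ} (hε : 0 < ε) :
    ∀ᶠ N : ℕ in atTop,
      Real.exp (-(#(box d N) * (s * a - (pressure d (β + s) h - pressure d β h) + |s| * δ + ε))) ≤
        (isingMeasure (zdGraph d) (box d N) β h bc).real
          {σ | |(-isingHamiltonian (zdGraph d) (box d N) h bc σ) / #(box d N) - a| < δ} := by
  have hev1 : ∀ᶠ N : ℕ in atTop, pressure d (β + s) h - pressure d β h - ε / 2 <
      pressureIn (zdGraph d) (box d N) (β + s) h bc - pressureIn (zdGraph d) (box d N) β h bc :=
    (tendsto_pressureIn_beta_sub (d := d) β s h bc).eventually (lt_mem_nhds (by linarith))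
  have hev2 : ∀ᶠ N : ℕ in atTop, Real.exp (-(ε / 2 * #(box d N))) ≤ 1 / 2 := by
    have h1 : Tendsto (fun N : ℕ => Real.exp (-(ε / 2 * (#(box d N) : ℝ)))) atTop (𝓝 0) :=
      Real.tendsto_exp_atBot.comp (tendsto_neg_atTop_atBot.comp
        ((IsingPressure.tendsto_card_box_atTop hd).const_mul_atTop (by positivity)))
    exact h1.eventually (eventually_le_nhds (by norm_num))
  filter_upwards [hW, hev1, hev2] with N hN h1 h2
  have hΛ := box_nonempty d N
  have hV : (0 : ℝ) < #(box d N) := by exact_mod_cast hΛ.card_pos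
  have htilt := exp_mul_measureReal_energyWindow_le (zdGraph d) (box d N) β s h bc (a * #(box d N)) (δ * #(box d N))
  rw [← setOf_abs_energy_div_sub_lt_eq hΛ, isingPartitionFunction_beta_div_eq_exp_card_mul (zdGraph d) hΛ] at htilt
  refine le_trans ?_ htilt
  have hpos1 : 0 < Real.exp (-(s * (a * #(box d N))) - |s| * (δ * #(box d N))) *
      Real.exp (#(box d N) * (pressureIn (zdGraph d) (box d N) (β + s) h bc - pressureIn (zdGraph d) (box d N) β h bc)) :=
    by positivity
  calc Real.exp (-(#(box d N) * (s * a - (pressure d (β + s) h - pressure d β h) + |s| * δ + ε)))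
      = Real.exp (-(s * (a * #(box d N))) - |s| * (δ * #(box d N))) *
          Real.exp (#(box d N) * (pressure d (β + s) h - pressure d β h - ε / 2)) *
          Real.exp (-(ε / 2 * #(box d N))) := by
        rw [← Real.exp_add, ← Real.exp_add]; congr 1; ring
    _ ≤ Real.exp (-(s * (a * #(box d N))) - |s| * (δ * #(box d N))) *
          Real.exp (#(box d N) * (pressureIn (zdGraph d) (box d N) (β + s) h bc -
            pressureIn (zdGraph d) (box d N) β h bc)) * (1 / 2) :=
        mul_le_mul (mul_le_mul_of_nonneg_left (Real.exp_le_exp.2 (mul_le_mul_of_nonneg_left h1.le hV.le))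
          (Real.exp_pos _).le) h2 (Real.exp_pos _).le (by positivity)
    _ ≤ _ := mul_le_mul_of_nonneg_left hN hpos1.le

/-- **THE LOWER LARGE-DEVIATION BOUND FOR THE ENERGY AT AN EXPOSED POINT** (`d ≥ 1`): if `ψ(·,h)` is differentiable at
`β + s` with derivative `D`, then for every `δ > 0`, `ε > 0` and EVERY boundary condition, eventually
`exp(−|Λ_N| (sD − (ψ(β+s,h) − ψ(β,h)) + |s|δ + ε)) ≤ μ^{bc}_{Λ_N;β,h}{|−H_N/|Λ_N| − D| < δ}`: the window around the exposed
point `D` has mass `→ 1` under the tilted states `μ^{bc}_{Λ_N;β+s,h}` (`energy_exp_concentration_of_hasDerivAt`).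
[cite: Ellis2006, Thm. II.6.1 (c) and §IV.7; Lanford1973] -/
theorem energy_ld_lower_bound_of_hasDerivAt (hd : 1 ≤ d) {β s h D : ℝ}
    (hD : HasDerivAt (fun b => pressure d b h) D (β + s)) {δ : ℝ} (hδ : 0 < δ) {ε : ℝ} (hε : 0 < ε)
    (bc : BoundaryCondition (Site d)) :
    ∀ᶠ N : ℕ in atTop,
      Real.exp (-(#(box d N) * (s * D - (pressure d (β + s) h - pressure d β h) + |s| * δ + ε))) ≤
        (isingMeasure (zdGraph d) (box d N) β h bc).real
          {σ | |(-isingHamiltonian (zdGraph d) (box d N) h bc σ) / #(box d N) - D| < δ} := by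
  obtain ⟨c, hc, hconc⟩ := energy_exp_concentration_of_hasDerivAt hd hD hδ
  have hW : ∀ᶠ N : ℕ in atTop, (1 / 2 : ℝ) ≤
      (isingMeasure (zdGraph d) (box d N) (β + s) h bc).real
        {σ | |(-isingHamiltonian (zdGraph d) (box d N) h bc σ) / #(box d N) - D| < δ} := by
    have hsmall : ∀ᶠ N : ℕ in atTop, Real.exp (-(c * #(box d N))) ≤ 1 / 2 := by
      have h1 : Tendsto (fun N : ℕ => Real.exp (-(c * (#(box d N) : ℝ)))) atTop (𝓝 0) :=
        Real.tendsto_exp_atBot.comp (tendsto_neg_atTop_atBot.comp ((IsingPressure.tendsto_card_box_atTop hd).const_mul_atTop hc))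
      exact h1.eventually (eventually_le_nhds (by norm_num))
    filter_upwards [hconc bc, hsmall] with N hN h2
    set μ := isingMeasure (zdGraph d) (box d N) (β + s) h bc
    have hcompl : {σ : SpinConfig (Site d) | |(-isingHamiltonian (zdGraph d) (box d N) h bc σ) / #(box d N) - D| < δ} =
        {σ | δ ≤ |(-isingHamiltonian (zdGraph d) (box d N) h bc σ) / #(box d N) - D|}ᶜ := by
      ext σ; simp only [mem_setOf_eq, mem_compl_iff, not_le]
    have hmeas : MeasurableSet
        {σ : SpinConfig (Site d) | δ ≤ |(-isingHamiltonian (zdGraph d) (box d N) h bc σ) / #(box d N) - D|} :=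
      measurableSet_le measurable_const
        (((measurable_isingHamiltonian (zdGraph d) (box d N) h bc).neg.div_const _).sub_const _).abs
    rw [hcompl, measureReal_compl hmeas, probReal_univ]
    linarith
  exact eventually_exp_le_measureReal_energyWindow hd β s h bc D δ hW hε

/-- **Tangent lines lie below the convex `ψ(·,h)`**: `ψ(b,h) + D (u − b) ≤ ψ(u,h)` for every `u`, when `∂ψ/∂β(b,h) = D`.
[cite: FriedliVelenik2017, Thm. 3.6 (convexity of the pressure in β)] -/
theorem pressure_beta_tangent_le {b h D : ℝ} (hD : HasDerivAt (fun t => pressure d t h) D b) (u : ℝ) :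
    pressure d b h + D * (u - b) ≤ pressure d u h := by
  have hconv := IsingEnergyDensity.convexOn_pressure_beta (d := d) h
  rcases lt_trichotomy u b with hu | rfl | hu
  · have h1 := hconv.slope_le_of_hasDerivAt (mem_univ u) (mem_univ b) hu hD
    rw [slope_def_field] at h1
    have h2 := (div_le_iff₀ (sub_pos.2 hu)).1 h1
    linarith
  · simp
  · have h1 := hconv.le_slope_of_hasDerivAt (mem_univ b) (mem_univ u) hu hD
    rw [slope_def_field] at h1
    have h2 := (le_div_iff₀ (sub_pos.2 hu)).1 h1
    linarith

/-- **THE LEGENDRE TRANSFORM IS ATTAINED AT THE EXPOSING INVERSE TEMPERATURE**: if `∂ψ/∂β(β+s,h) = D` then for every real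
`u`, `uD − (ψ(β+u,h) − ψ(β,h)) ≤ sD − (ψ(β+s,h) − ψ(β,h))`: the exponent of `energy_ld_lower_bound_of_hasDerivAt` is the
supremum defining the rate of the Chernoff upper bounds of `EnergyLargeDeviations` — upper and lower volume-order
exponents coincide at exposed points. [cite: Ellis2006, (2.28), Thm. II.6.1 and §IV.7] -/
theorem energy_rate_le_rate_of_hasDerivAt {β s h D : ℝ} (hD : HasDerivAt (fun b => pressure d b h) D (β + s)) (u : ℝ) :
    u * D - (pressure d (β + u) h - pressure d β h) ≤ s * D - (pressure d (β + s) h - pressure d β h) := by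
  have := pressure_beta_tangent_le (d := d) hD (β + u)
  nlinarith

/-- **THE ENERGY RATE IS NONPOSITIVE BETWEEN THE ONE-SIDED `β`-SLOPES**: if `∂⁻ψ/∂β(β,h) = Dl ≤ D ≤ Dr = ∂⁺ψ/∂β(β,h)` then
`uD − (ψ(β+u,h) − ψ(β,h)) ≤ 0` for every `u` (convexity: right chords `≥ Dr`, left chords `≤ Dl`); so the Legendre transform
of `u ↦ ψ(β+u,h) − ψ(β,h)` vanishes on `[Dl, Dr]`. [cite: Ellis2006, Example II.6.2 and Thm. II.6.1; FriedliVelenik2017, Thm. 3.6] -/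
theorem energy_rate_nonpos_of_mem_Icc {β h Dl Dr D : ℝ} (hR : HasDerivWithinAt (fun b => pressure d b h) Dr (Ici β) β)
    (hL : HasDerivWithinAt (fun b => pressure d b h) Dl (Iic β) β) (hm : Dl ≤ D ∧ D ≤ Dr) (u : ℝ) :
    u * D - (pressure d (β + u) h - pressure d β h) ≤ 0 := by
  have hconv := IsingEnergyDensity.convexOn_pressure_beta (d := d) h
  rcases lt_trichotomy u 0 with hu | rfl | hu
  · have hlt : β + u < β := by linarith
    have h1 := hconv.slope_le_of_hasDerivWithinAt_Iio (mem_univ _) (mem_univ _) hlt (hL.mono Iio_subset_Iic_self)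
    rw [slope_def_field] at h1
    have hpos : 0 < β - (β + u) := by linarith
    have h2 := (div_le_iff₀ hpos).1 h1
    nlinarith [hm.1]
  · simp
  · have hlt : β < β + u := by linarith
    have h1 := hconv.le_slope_of_hasDerivWithinAt_Ioi (mem_univ _) (mem_univ _) hlt (hR.mono Ioi_subset_Ici_self)
    rw [slope_def_field] at h1
    have hpos : 0 < β + u - β := by linarith
    have h2 := (le_div_iff₀ hpos).1 h1
    nlinarith [hm.2]

/-- **THE LATENT-HEAT PLATEAU AT ZERO FIELD** (`β > 0`): for every `u` with
`Σᵢ ⟨σ_0σ_{eᵢ}⟩^∅_β ≤ u ≤ Σᵢ ⟨σ_0σ_{eᵢ}⟩⁺_β` and every real `t`, `tu − (ψ(β+t,0) − ψ(β,0)) ≤ 0`: the volume-order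
large-deviation rate of the energy density VANISHES on the whole interval between Lebowitz's free and plus
nearest-neighbour energies, the one-sided `β`-derivatives of the pressure (`hasDerivWithinAt_pressure_beta_Iic/Ici`).
When `ψ(·,0)` is differentiable at `β` the interval is a point (Lebowitz's Thm. 2); a first-order transition in `β` would
make it a nondegenerate latent-heat segment. [cite: Lebowitz1977, §3 Thm. 2, p. 470; Ellis2006, Example II.6.2 and §IV.7] -/
theorem energy_rate_nonpos_zero_field_of_mem_Icc {β : ℝ} (hβ : 0 < β) {u : ℝ}
    (hu : ∑ i, freeCorr d β 0 {0, Pi.single i 1} ≤ u ∧ u ≤ ∑ i, plusCorr d β 0 {0, Pi.single i 1}) (t : ℝ) :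
    t * u - (pressure d (β + t) 0 - pressure d β 0) ≤ 0 :=
  energy_rate_nonpos_of_mem_Icc (IsingEnergyDensity.hasDerivWithinAt_pressure_beta_Ici (d := d) hβ.le)
    (IsingEnergyDensity.hasDerivWithinAt_pressure_beta_Iic (d := d) hβ) hu t

/-- **THE RATE IS POSITIVE OFF THE PLATEAU, ABOVE**: for `u > Σᵢ ⟨σ_0σ_{eᵢ}⟩⁺_β` (`β ≥ 0`) there is `s > 0` with
`su − (ψ(β+s,0) − ψ(β,0)) > 0` — the Chernoff exponent of `EnergyLargeDeviations` is then strictly positive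
(`exists_pos_rate_of_hasDerivWithinAt_Ici` at the right derivative). [cite: Ellis2006, Thm. II.6.3; Lebowitz1977, Thm. 2] -/
theorem energy_rate_pos_zero_field_of_lt {β : ℝ} (hβ : 0 ≤ β) {u : ℝ} (hu : ∑ i, plusCorr d β 0 {0, Pi.single i 1} < u) :
    ∃ s : ℝ, 0 < s ∧ 0 < s * u - (pressure d (β + s) 0 - pressure d β 0) :=
  exists_pos_rate_of_hasDerivWithinAt_Ici (IsingEnergyDensity.hasDerivWithinAt_pressure_beta_Ici (d := d) hβ) hu

/-- **THE RATE IS POSITIVE OFF THE PLATEAU, BELOW**: for `u < Σᵢ ⟨σ_0σ_{eᵢ}⟩^∅_β` (`β > 0`) there is `s > 0` with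
`−su − (ψ(β−s,0) − ψ(β,0)) > 0`. [cite: Ellis2006, Thm. II.6.3; Lebowitz1977, Thm. 2] -/
theorem energy_rate_pos_zero_field_of_gt {β : ℝ} (hβ : 0 < β) {u : ℝ} (hu : u < ∑ i, freeCorr d β 0 {0, Pi.single i 1}) :
    ∃ s : ℝ, 0 < s ∧ 0 < -(s * u) - (pressure d (β - s) 0 - pressure d β 0) :=
  exists_pos_rate_of_hasDerivWithinAt_Iic (IsingEnergyDensity.hasDerivWithinAt_pressure_beta_Iic (d := d) hβ) hu

/-- **THE PLUS ENERGY IS TYPICAL-OR-CHEAP UNDER EVERY BOUNDARY CONDITION** (`d ≥ 1`, `β ≥ 0`, `h = 0`): for every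
`δ, ε > 0` and every b.c., eventually `e^{−ε|Λ_N|} ≤ μ^{bc}_{Λ_N;β,0}{|−H_N/|Λ_N| − Σᵢ⟨σ_0σ_{eᵢ}⟩⁺_β| < δ}`. Proof: exposed
inverse temperatures `b > β` are dense (`ψ(·,0)` is differentiable off a countable set), `∂ψ/∂β(b,0) = Σᵢ⟨σ_0σ_{eᵢ}⟩⁺_b → Σᵢ⟨σ_0σ_{eᵢ}⟩⁺_β`
as `b ↓ β`, and the exponent `(b−β)∂ψ/∂β(b) − (ψ(b) − ψ(β)) + (b−β)δ/2` of `energy_ld_lower_bound_of_hasDerivAt` is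
`≤ (b − β)δ → 0` by the chord inequality `ψ(b) − ψ(β) ≥ (b−β) Σᵢ⟨σ_0σ_{eᵢ}⟩⁺_β`.
[cite: Ellis2006, Thm. II.6.1 (c) and Example II.6.2; Lebowitz1977, §3 Thm. 2 and Remark (i)] -/
theorem energy_ld_lower_plus_nn (hd : 1 ≤ d) {β : ℝ} (hβ : 0 ≤ β) {δ : ℝ} (hδ : 0 < δ) {ε : ℝ} (hε : 0 < ε)
    (bc : BoundaryCondition (Site d)) :
    ∀ᶠ N : ℕ in atTop,
      Real.exp (-(ε * #(box d N))) ≤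
        (isingMeasure (zdGraph d) (box d N) β 0 bc).real
          {σ | |(-isingHamiltonian (zdGraph d) (box d N) 0 bc σ) / #(box d N) - ∑ i, plusCorr d β 0 {0, Pi.single i 1}| < δ} := by
  set Pβ : ℝ := ∑ i, plusCorr d β 0 {0, Pi.single i 1} with hPβ
  have hη : 0 < ε / (3 * δ) := by positivity
  have hS : {b : ℝ | (∑ i, plusCorr d b 0 {0, Pi.single i 1}) ∈ Ioo (Pβ - δ / 2) (Pβ + δ / 2)} ∩
      Ioo β (β + ε / (3 * δ)) ∈ 𝓝[>] β :=
    inter_mem ((IsingEnergyDensity.tendsto_sum_plusCorr_nn_nhdsGT (d := d) hβ).eventually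
      (Ioo_mem_nhds (by linarith) (by linarith))) (Ioo_mem_nhdsGT (lt_add_of_pos_right β hη))
  obtain ⟨u, hu, hsub⟩ := mem_nhdsGT_iff_exists_Ioo_subset.1 hS
  obtain ⟨b, hbgood, hbI⟩ :=
    ((IsingEnergyDensity.countable_not_differentiableAt_pressure_beta (d := d)).dense_compl ℝ).exists_mem_open
      isOpen_Ioo (nonempty_Ioo.2 hu)
  obtain ⟨hPb, hbβ⟩ := hsub hbI
  have hb0 : 0 < b := hβ.trans_lt hbβ.1
  have hdiff : DifferentiableAt ℝ (fun t => pressure d t 0) b := by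
    by_contra hnd
    exact hbgood ⟨hb0, hnd⟩
  set Pb : ℝ := ∑ i, plusCorr d b 0 {0, Pi.single i 1} with hPb_def
  have hbb : β + (b - β) = b := by ring
  have hD : HasDerivAt (fun t => pressure d t 0) Pb (β + (b - β)) := by
    rw [hbb]
    exact IsingEnergyDensity.hasDerivAt_pressure_beta_of_sum_eq hb0
      ((IsingEnergyDensity.differentiableAt_pressure_beta_iff hb0).1 hdiff)
  have hchord := IsingEnergyDensity.sum_plusCorr_nn_le_slope_pressure_beta (d := d) hβ hbβ.1
  rw [slope_def_field, le_div_iff₀ (sub_pos.2 hbβ.1)] at hchord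
  have hPb' : |Pb - Pβ| < δ / 2 := by
    rw [abs_sub_lt_iff]; constructor <;> linarith [hPb.1, hPb.2]
  have hs_le : (b - β) * δ ≤ ε / 3 := by
    have h3 : b - β ≤ ε / (3 * δ) := by linarith [hbβ.2]
    calc (b - β) * δ ≤ ε / (3 * δ) * δ := mul_le_mul_of_nonneg_right h3 hδ.le
      _ = ε / 3 := by field_simp
  have h4 : (b - β) * (Pb - Pβ) ≤ (b - β) * (δ / 2) :=
    mul_le_mul_of_nonneg_left (le_of_lt (abs_sub_lt_iff.1 hPb').1) (sub_pos.2 hbβ.1).le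
  have hE : (b - β) * Pb - (pressure d b 0 - pressure d β 0) + |b - β| * (δ / 2) + ε / 3 ≤ ε := by
    rw [abs_of_pos (sub_pos.2 hbβ.1)]
    linarith
  filter_upwards [energy_ld_lower_bound_of_hasDerivAt hd hD (half_pos hδ) (by positivity : (0 : ℝ) < ε / 3) bc]
    with N hN
  rw [hbb] at hN
  have hV : (0 : ℝ) ≤ #(box d N) := by positivity
  calc Real.exp (-(ε * #(box d N)))
      ≤ Real.exp (-(#(box d N) * ((b - β) * Pb - (pressure d b 0 - pressure d β 0) + |b - β| * (δ / 2) + ε / 3))) :=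
        Real.exp_le_exp.2 (by nlinarith [mul_le_mul_of_nonneg_left hE hV])
    _ ≤ _ := hN
    _ ≤ _ := by
        refine measureReal_mono fun σ hσ => ?_
        simp only [mem_setOf_eq] at hσ ⊢
        have h1 := abs_sub_lt_iff.1 hσ
        have h2 := abs_sub_lt_iff.1 hPb'
        rw [abs_sub_lt_iff]
        constructor <;> linarith

/-- **THE FREE ENERGY IS TYPICAL-OR-CHEAP UNDER EVERY BOUNDARY CONDITION** (`d ≥ 1`, `β > 0`, `h = 0`): for every
`δ, ε > 0` and every b.c., eventually `e^{−ε|Λ_N|} ≤ μ^{bc}_{Λ_N;β,0}{|−H_N/|Λ_N| − Σᵢ⟨σ_0σ_{eᵢ}⟩^∅_β| < δ}` (exposed `b ↑ β`,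
left-continuity of the free energy, chord inequality `ψ(β) − ψ(b) ≤ (β−b) Σᵢ⟨σ_0σ_{eᵢ}⟩^∅_β`). Together with
`energy_ld_lower_plus_nn`: even under `+` boundary conditions the FREE energy density is reached at sub-volume-order
cost, and vice versa — at volume order the boundary condition cannot separate the two ends of the latent-heat interval.
[cite: Ellis2006, Thm. II.6.1 (c) and Example II.6.2; Lebowitz1977, §3 Thm. 2 and Remark (i)] -/
theorem energy_ld_lower_free_nn (hd : 1 ≤ d) {β : ℝ} (hβ : 0 < β) {δ : ℝ} (hδ : 0 < δ) {ε : ℝ} (hε : 0 < ε)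
    (bc : BoundaryCondition (Site d)) :
    ∀ᶠ N : ℕ in atTop,
      Real.exp (-(ε * #(box d N))) ≤
        (isingMeasure (zdGraph d) (box d N) β 0 bc).real
          {σ | |(-isingHamiltonian (zdGraph d) (box d N) 0 bc σ) / #(box d N) - ∑ i, freeCorr d β 0 {0, Pi.single i 1}| < δ} := by
  set Fβ : ℝ := ∑ i, freeCorr d β 0 {0, Pi.single i 1} with hFβ
  have hη : 0 < ε / (3 * δ) := by positivity
  have hS : {b : ℝ | (∑ i, freeCorr d b 0 {0, Pi.single i 1}) ∈ Ioo (Fβ - δ / 2) (Fβ + δ / 2)} ∩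
      Ioo (max (β / 2) (β - ε / (3 * δ))) β ∈ 𝓝[<] β :=
    inter_mem ((IsingEnergyDensity.tendsto_sum_freeCorr_nn_nhdsLT (d := d) hβ).eventually
      (Ioo_mem_nhds (by linarith) (by linarith))) (Ioo_mem_nhdsLT (max_lt (by linarith) (by linarith)))
  obtain ⟨u, hu, hsub⟩ := mem_nhdsLT_iff_exists_Ioo_subset.1 hS
  obtain ⟨b, hbgood, hbI⟩ :=
    ((IsingEnergyDensity.countable_not_differentiableAt_pressure_beta (d := d)).dense_compl ℝ).exists_mem_open
      isOpen_Ioo (nonempty_Ioo.2 hu)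
  obtain ⟨hFb, hbβ⟩ := hsub hbI
  have hb0 : 0 < b := by
    have := hbβ.1
    have : β / 2 < b := lt_of_le_of_lt (le_max_left _ _) this
    linarith
  have hbε : β - ε / (3 * δ) < b := lt_of_le_of_lt (le_max_right _ _) hbβ.1
  have hdiff : DifferentiableAt ℝ (fun t => pressure d t 0) b := by
    by_contra hnd
    exact hbgood ⟨hb0, hnd⟩
  set Fb : ℝ := ∑ i, freeCorr d b 0 {0, Pi.single i 1} with hFb_def
  have heq : Fb = ∑ i, plusCorr d b 0 {0, Pi.single i 1} :=
    (IsingEnergyDensity.differentiableAt_pressure_beta_iff hb0).1 hdiff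
  have hbb : β + (b - β) = b := by ring
  have hD : HasDerivAt (fun t => pressure d t 0) Fb (β + (b - β)) := by
    rw [hbb, heq]
    exact IsingEnergyDensity.hasDerivAt_pressure_beta_of_sum_eq hb0 heq
  have hchord := IsingEnergyDensity.slope_pressure_beta_le_sum_freeCorr_nn (d := d) hβ.le hbβ.2
  rw [slope_def_field, div_le_iff₀ (sub_pos.2 hbβ.2)] at hchord
  have hFb' : |Fb - Fβ| < δ / 2 := by
    rw [abs_sub_lt_iff]; constructor <;> linarith [hFb.1, hFb.2]
  have hs_le : (β - b) * δ ≤ ε / 3 := by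
    have h3 : β - b ≤ ε / (3 * δ) := by linarith
    calc (β - b) * δ ≤ ε / (3 * δ) * δ := mul_le_mul_of_nonneg_right h3 hδ.le
      _ = ε / 3 := by field_simp
  have h4 : (β - b) * (Fβ - Fb) ≤ (β - b) * (δ / 2) :=
    mul_le_mul_of_nonneg_left (le_of_lt (abs_sub_lt_iff.1 hFb').2) (sub_pos.2 hbβ.2).le
  have hE : (b - β) * Fb - (pressure d b 0 - pressure d β 0) + |b - β| * (δ / 2) + ε / 3 ≤ ε := by
    rw [abs_of_neg (sub_neg.2 hbβ.2)]
    linarith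
  filter_upwards [energy_ld_lower_bound_of_hasDerivAt hd hD (half_pos hδ) (by positivity : (0 : ℝ) < ε / 3) bc]
    with N hN
  rw [hbb] at hN
  have hV : (0 : ℝ) ≤ #(box d N) := by positivity
  calc Real.exp (-(ε * #(box d N)))
      ≤ Real.exp (-(#(box d N) * ((b - β) * Fb - (pressure d b 0 - pressure d β 0) + |b - β| * (δ / 2) + ε / 3))) :=
        Real.exp_le_exp.2 (by nlinarith [mul_le_mul_of_nonneg_left hE hV])
    _ ≤ _ := hN
    _ ≤ _ := by
        refine measureReal_mono fun σ hσ => ?_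
        simp only [mem_setOf_eq] at hσ ⊢
        have h1 := abs_sub_lt_iff.1 hσ
        have h2 := abs_sub_lt_iff.1 hFb'
        rw [abs_sub_lt_iff]
        constructor <;> linarith

end IsingLargeDeviations

end Summit.CriticalPhenomena.PercolationContinuityZ3.Theorems.FK
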